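import Mathlib
import Summits.Ventures.HodgeRepro.Tier4.Target
import Summits.Ventures.HodgeRepro.Tier4.Line3.KMDatum
import Summits.Ventures.HodgeRepro.Tier4.Line3.Majorant

/-!
# Tier4/Line3/ArchSize — the archimedean-size rung R5 with denominators (rung for L3.4 / L3.5)

Blind re-derivation cell `pub-hodge-repro`, Tier 4 «PROVE THE STEP» (README §9–§10), LINE L3 (orbit expansion of the
quadruple theta period), seat t4-L2-p3 on L3.5 `term_dominated` (lead S12234).

The landed rung R5 (`Majorant.rung_archimedean_size`, t4-plan-3): a non-zero INTEGRAL `β ∈ 𝔭^N` is large at some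
embedding, `N(𝔭)^N ≤ ‖σ β‖^d`.  The depth-`N` congruence ball of the line is LOCAL at `𝔭` — its elements are
`𝔭^N`-divisible only up to a denominator `a ∉ 𝔭` — and the Gram deviation of an off-main tuple is an element of `E`
with a fixed denominator `D₀` (from the support lattices and the main tuple).  This file supplies the two bookkeeping
steps that feed such an element into R5:

* `mem_pow_of_mul_mem_pow` — `𝔭^N` is `𝔭`-primary: `a ∉ 𝔭`, `a β ∈ 𝔭^N` ⇒ `β ∈ 𝔭^N` (Dedekind domain; `Prime` of the
  ideal `𝔭` in the monoid of ideals, `Prime.pow_dvd_of_dvd_mul_left`);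
* `rung_archimedean_size_of_mul_mem` — R5 for `β` with a denominator prime to `𝔭`;
* `rung_archimedean_size_of_denom` — R5 for `α ∈ E` with `D₀ α ∈ 𝒪` (`D₀ ≠ 0` fixed): `N(𝔭)^N ≤ ‖σ D₀‖^d · ‖σ α‖^d`
  at some `σ` (so `‖σ α‖^d ≥ N(𝔭)^N / max_σ ‖σ D₀‖^d`).

Nothing here asserts anything about the truth of (P); HC_CM is NOT proved by anyone in this repository.
-/

set_option autoImplicit false

namespace Summit.Ventures.HodgeRepro.Tier4.Line3

open NumberField

/-- **`𝔭^N` is `𝔭`-primary.** In a Dedekind domain, `a ∉ 𝔭` and `a β ∈ 𝔭^N` force `β ∈ 𝔭^N`. -/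
theorem mem_pow_of_mul_mem_pow {R : Type*} [CommRing R] [IsDedekindDomain R]
    (p : IsDedekindDomain.HeightOneSpectrum R) (N : ℕ) {a β : R} (ha : a ∉ p.asIdeal)
    (h : a * β ∈ p.asIdeal ^ N) : β ∈ p.asIdeal ^ N := by
  have hP : Prime p.asIdeal := Ideal.prime_of_isPrime p.ne_bot p.isPrime
  have h1 : ¬ p.asIdeal ∣ Ideal.span {a} := by
    rwa [Ideal.dvd_span_singleton]
  have h2 : p.asIdeal ^ N ∣ Ideal.span {a} * Ideal.span {β} := by
    rw [Ideal.span_singleton_mul_span_singleton, Ideal.dvd_span_singleton]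
    exact h
  have h3 := hP.pow_dvd_of_dvd_mul_left N h1 h2
  rwa [Ideal.dvd_span_singleton] at h3

/-- **R5 with a denominator prime to `𝔭`.** If `a ∉ 𝔭`, `a β ∈ 𝔭^N` and `β ≠ 0`, then `N(𝔭)^N ≤ ‖σ β‖^d` at some
embedding `σ` (`d = [E : ℚ]`). -/
theorem rung_archimedean_size_of_mul_mem (E : Type) [Field E] [NumberField E]
    (p : IsDedekindDomain.HeightOneSpectrum (RingOfIntegers E)) (N : ℕ)
    {a β : RingOfIntegers E} (ha : a ∉ p.asIdeal) (h : a * β ∈ p.asIdeal ^ N) (h0 : β ≠ 0) :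
    ∃ σ : E →+* ℂ, ((Ideal.absNorm p.asIdeal : ℝ) ^ N) ≤ ‖σ β‖ ^ Module.finrank ℚ E :=
  rung_archimedean_size E p N β (mem_pow_of_mul_mem_pow p N ha h) h0

/-- **R5 for an element of `E` with a fixed denominator.** If `D₀ ≠ 0` is an algebraic integer with `D₀ α = β`
integral, `a ∉ 𝔭`, `a β ∈ 𝔭^N` and `α ≠ 0`, then `N(𝔭)^N ≤ ‖σ D₀‖^d · ‖σ α‖^d` at some embedding `σ`. -/
theorem rung_archimedean_size_of_denom (E : Type) [Field E] [NumberField E]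
    (p : IsDedekindDomain.HeightOneSpectrum (RingOfIntegers E)) (N : ℕ)
    {a D₀ β : RingOfIntegers E} {α : E} (hβ : (β : E) = (D₀ : E) * α)
    (ha : a ∉ p.asIdeal) (h : a * β ∈ p.asIdeal ^ N) (hD : D₀ ≠ 0) (hα : α ≠ 0) :
    ∃ σ : E →+* ℂ, ((Ideal.absNorm p.asIdeal : ℝ) ^ N) ≤
      ‖σ D₀‖ ^ Module.finrank ℚ E * ‖σ α‖ ^ Module.finrank ℚ E := by
  have h0 : β ≠ 0 := by
    intro hβ0
    rw [hβ0] at hβ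
    have : ((D₀ : E) * α) = 0 := by
      rw [← hβ]
      simp
    rcases mul_eq_zero.mp this with hD0 | hα0
    · exact hD ((RingOfIntegers.coe_eq_zero_iff).mp hD0)
    · exact hα hα0
  obtain ⟨σ, hσ⟩ := rung_archimedean_size_of_mul_mem E p N ha h h0
  refine ⟨σ, ?_⟩
  have hcoe : σ β = σ D₀ * σ α := by
    rw [← map_mul, hβ]
  rw [hcoe, norm_mul, mul_pow] at hσ
  exact hσ

end Summit.Ventures.HodgeRepro.Tier4.Line3
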